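import Summits.CriticalPhenomena.PercolationContinuityZ3.Theorems.SahiMasterFamilyGluedFramesPure
import Summits.CriticalPhenomena.PercolationContinuityZ3.Theorems.SahiMasterFamilyStructSym
import Summits.CriticalPhenomena.PercolationContinuityZ3.Theorems.SahiMasterFamilyTightFrames

/-!
# Structure theory of the zero-flag class: annihilator points fail two PURE members; frames are hulls over the pure blocks

Unit `prim-master-conj` (crux anchor stmt-CriticalPhenomena-4575), gen 12; memo HOME/prim-master-conj/TIGHTNESS-IV.md §1.
Two order-free consequences of the gen-6 structure theory (`Structured`, canonical frames `cframe`, C = `structured_erase_of_not_subset`,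
SYM = `annihilator_subset_safe_erase`, FR = `cframe_eq_of_robust`, and gen 11's `GluedFrames.exists_two_pure`), census-exact on
`{0,1}^4`, `k ≤ 5` (every structured family; 1,036,502 annihilator points at `k = 5`, 0 exceptions) and proved here for every order:

* **`two_le_card_pureFail`** (α): in a structured family, a configuration of the annihilator of a member `y` (canonical frame minus member)
  fails at least two PURE members other than `y` (pure = canonical frame equals member).  Proof: `W ∖ y` is structured (C) and the annihilator
  is safe for it (SYM), so every sub-family between the fail set `F` of the configuration and `W ∖ y` is structured; hence the canonical frames
  restrict all the way down to `F` (FR), and the two pure members of the structured family `F` (`exists_two_pure`) are pure in `W`.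
* **`cframe_eq_hull_pureSupp`** (β): the canonical frame of every member is the hull of the member over the union of the blocks of the OTHER
  pure members — the frame is reached by opening the pure blocks alone.  Proof: a frame configuration whose pure-saturation is outside the member
  would be an annihilator point lying in every pure member, contradicting (α).
These are the inputs of the order-five local-to-global analysis (TIGHTNESS-IV §2).  Pure combinatorics; axioms standard. [this work]
-/

noncomputable section

open scoped Classical

namespace Summit.CriticalPhenomena.PercolationContinuityZ3.Theorems

namespace GluedFrames

open Finset Function
open Literature.Probability.LatticeModels.Kahn2022 (Affects)

variable {ι : Type*} [Fintype ι] {κ : Type*} (U : κ → Set (Set ι))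

/-! ### (α): annihilator points fail two pure members -/

/-- Membership in the set of PURE members `W.filter (cframe = member)` (kept as an explicit filter; no new definition). [this work] -/
theorem mem_pures {W : Finset κ} {p : κ} : p ∈ (W.filter fun p => cframe U W p = U p) ↔ p ∈ W ∧ cframe U W p = U p := by
  simp

/-- **(α) Annihilator points fail two pure members.**  In a structured family of non-empty increasing events, a configuration `φ` of the
annihilator of `y` (in the canonical frame of `y`, outside `U y`) lies outside at least two members `p ≠ y` that are PURE (`cframe p = U p`).
[this work] -/
theorem two_le_card_pureFail (hU : ∀ k, IsUpperSet (U k)) (hne : ∀ k, (U k).Nonempty) {W : Finset κ} (hW : Structured U W)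
    {y : κ} (hy : y ∈ W) {φ : Set ι} (hφA : φ ∈ cframe U W y) (hφU : φ ∉ U y) :
    2 ≤ ((((W.filter fun p => cframe U W p = U p)).erase y).filter fun p => φ ∉ U p).card := by
  have hN : ¬ (cframe U W y ⊆ U y) := fun h => hφU (h hφA)
  have hWy : Structured U (W.erase y) := structured_erase_of_not_subset U hU hne hW hy hN
  have hsafe : φ ∈ Safe U (W.erase y) := annihilator_subset_safe_erase U hU hne hW hy hWy ⟨hφA, hφU⟩
  obtain ⟨h2, hrob⟩ := (mem_safe U).1 hsafe
  set F := failSet U (W.erase y) φ with hFdef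
  have hFW : F ⊆ W.erase y := failSet_subset U _ φ
  have hF : Structured U F := hrob F subset_rfl hFW
  -- the canonical frames restrict from `W` to `W ∖ y` (FR) and from `W ∖ y` down to `F` (robustness)
  have hfr : ∀ w ∈ F, cframe U F w = cframe U W w := by
    intro w hw
    rw [cframe_eq_of_robust U hU hne ((W.erase y) \ F).card le_rfl hWy hFW (fun R' h1 h2 => hrob R' h1 h2) w hw]
    exact cframe_erase U hU hne hW hWy (hFW hw)
  -- two pure members of `F`
  obtain ⟨a, ha, b, hb, hab, hfa, hfb⟩ := exists_two_pure U hU hne hF h2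
  have hmem : ∀ {c}, c ∈ F → cframe U F c = U c → c ∈ (((W.filter fun p => cframe U W p = U p)).erase y).filter fun p => φ ∉ U p := by
    intro c hc hfc
    have hc' := (mem_failSet U).1 hc
    rw [mem_filter, mem_erase, mem_pures]
    exact ⟨⟨ne_of_mem_erase hc'.1, mem_of_mem_erase hc'.1, by rw [← hfr c hc, hfc]⟩, hc'.2⟩
  have hsub : ({a, b} : Finset κ) ⊆ (((W.filter fun p => cframe U W p = U p)).erase y).filter fun p => φ ∉ U p := by
    intro c hc
    rcases mem_insert.1 hc with rfl | hc
    · exact hmem ha hfa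
    · rw [mem_singleton] at hc; subst hc; exact hmem hb hfb
  have := card_le_card hsub
  rw [card_pair hab] at this
  exact this

/-- (α), member form: at least two pure members `≠ y` fail at the annihilator point. [this work] -/
theorem exists_two_pure_not_mem (hU : ∀ k, IsUpperSet (U k)) (hne : ∀ k, (U k).Nonempty) {W : Finset κ} (hW : Structured U W)
    {y : κ} (hy : y ∈ W) {φ : Set ι} (hφA : φ ∈ cframe U W y) (hφU : φ ∉ U y) :
    ∃ a ∈ W, ∃ b ∈ W, a ≠ b ∧ a ≠ y ∧ b ≠ y ∧ cframe U W a = U a ∧ cframe U W b = U b ∧ φ ∉ U a ∧ φ ∉ U b := by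
  obtain ⟨a, ha, b, hb, hab⟩ := one_lt_card.1 (two_le_card_pureFail U hU hne hW hy hφA hφU)
  rw [mem_filter, mem_erase, mem_pures] at ha hb
  exact ⟨a, ha.1.2.1, b, hb.1.2.1, hab, ha.1.1, hb.1.1, ha.1.2.2, hb.1.2.2, ha.2, hb.2⟩

/-! ### (β): frames are hulls over the pure blocks -/

/-! The PURE SUPPORT off `y`: `⋃ p ∈ (W.filter (cframe = member)).erase y, esupp (U p)` (written out; no new definition). -/

/-- The pure-saturation of any configuration lies in every pure member other than `y`. [this work] -/
theorem union_pureSupp_mem (hU : ∀ k, IsUpperSet (U k)) (hne : ∀ k, (U k).Nonempty) {W : Finset κ} {y p : κ}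
    (hp : p ∈ (W.filter fun p => cframe U W p = U p).erase y) (ω : Set ι) :
    ω ∪ (⋃ p ∈ (W.filter fun p => cframe U W p = U p).erase y, (↑(esupp (U p)) : Set ι)) ∈ U p :=
  TightFrames.mem_of_esupp_subset (hU p) (hne p) fun _ hx => Or.inr (Set.mem_biUnion hp hx)

/-- The pure blocks other than `y` miss the block of the canonical frame of `y` (structured family). [this work] -/
theorem disjoint_pureSupp_esupp_cframe (hU : ∀ k, IsUpperSet (U k)) (hne : ∀ k, (U k).Nonempty) {W : Finset κ}
    (hW : Structured U W) {y : κ} (hy : y ∈ W) :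
    Disjoint (⋃ p ∈ (W.filter fun p => cframe U W p = U p).erase y, (↑(esupp (U p)) : Set ι)) ↑(esupp (cframe U W y)) := by
  rw [Set.disjoint_iUnion₂_left]
  intro p hp
  have hp' := mem_pures U |>.1 (mem_of_mem_erase hp)
  have hd := disjoint_esupp_cframe U hU hne hW hp'.1 hy (ne_of_mem_erase hp)
  rw [hp'.2] at hd
  exact disjoint_coe.2 hd

/-- **(β) The canonical frame of a member of a structured family is the hull of the member over the pure blocks** (of the pure members other
than itself). [this work] -/
theorem cframe_eq_hull_pureSupp (hU : ∀ k, IsUpperSet (U k)) (hne : ∀ k, (U k).Nonempty) {W : Finset κ} (hW : Structured U W)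
    {y : κ} (hy : y ∈ W) :
    cframe U W y = hull (⋃ p ∈ (W.filter fun p => cframe U W p = U p).erase y, (↑(esupp (U p)) : Set ι)) (U y) := by
  ext ω
  constructor
  · intro hω
    rw [mem_hull]
    by_contra hωU
    -- `ω ∪ pureSupp` is an annihilator point lying in every pure member: contradicts (α)
    have hA : ω ∪ (⋃ p ∈ (W.filter fun p => cframe U W p = U p).erase y, (↑(esupp (U p)) : Set ι)) ∈ cframe U W y := isUpperSet_cframe U hU W y Set.subset_union_left hω
    obtain ⟨a, ha, b, _, _, hay, _, hfa, _, hφa, _⟩ := exists_two_pure_not_mem U hU hne hW hy hA hωU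
    exact hφa (union_pureSupp_mem U hU hne (mem_erase.2 ⟨hay, (mem_pures U).2 ⟨ha, hfa⟩⟩) ω)
  · intro hω
    rw [mem_hull] at hω
    have e := hull_eq_self_of_disjoint (isUpperSet_cframe U hU W y) (disjoint_pureSupp_esupp_cframe U hU hne hW hy)
    rw [← e, mem_hull]
    exact subset_cframe U hU W y hω

/-- (β), pointwise form: a configuration lies in the canonical frame of `y` iff opening the pure blocks (other than `y`'s) moves it into `U y`.
[this work] -/
theorem mem_cframe_iff_union_pureSupp_mem (hU : ∀ k, IsUpperSet (U k)) (hne : ∀ k, (U k).Nonempty) {W : Finset κ}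
    (hW : Structured U W) {y : κ} (hy : y ∈ W) (ω : Set ι) :
    ω ∈ cframe U W y ↔ ω ∪ (⋃ p ∈ (W.filter fun p => cframe U W p = U p).erase y, (↑(esupp (U p)) : Set ι)) ∈ U y := by
  rw [cframe_eq_hull_pureSupp U hU hne hW hy, mem_hull]

end GluedFrames

end Summit.CriticalPhenomena.PercolationContinuityZ3.Theorems
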